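import Literature.AlgebraicTopology.Homotopy.CompactManifoldCWType
import Literature.AlgebraicTopology.Homotopy.MappingTelescopeRetract
import Literature.AlgebraicTopology.Homotopy.MappingTelescopeHomotopy
import Literature.AlgebraicTopology.Homotopy.MappingTelescopeCWComplex
import Literature.Topology.Euclidean.LatticeCubeCellularApprox
import Mathlib.Topology.UniformSpace.UniformConvergenceTopology
import HarnessLib

/-!
# Compact Euclidean neighbourhood retracts have the homotopy type of CW complexes (Hatcher A.11 for compact ENRs, proved)

Topic `Literature/AlgebraicTopology/Homotopy`. This file DISCHARGES, for compact Euclidean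
neighbourhood retracts, the use of the named fact
`Literature.AlgebraicTopology.Homotopy.exists_cwComplex_homotopyEquiv_of_dominated` (Hatcher,
*Algebraic Topology* (2002), Prop. A.11) in `CompactManifoldCWType.lean`: a space `Y` with a
closed embedding `f : Y → ℝᴺ` whose compact image is a neighbourhood retract is homotopy
equivalent to a CW complex — PROVED here along Hatcher's proof of Prop. A.11 (p. 528):

1. a fine lattice cube complex `K`, `f(Y) ⊆ K ⊆ U` (`LatticeCubeComplex.lean`), and the strict
   retraction data `Y →ᶠ K →ʳ Y`, with idempotent `e = f r : K → K`
   (`Telescope.RetractionData`); `T(e) ≃ Y` (`MappingTelescopeRetract.lean`);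
2. a cellular map `g : K → K` uniformly close to `e`, with the segments `[g x, e x]` inside `K`
   (`LatticeCube.exists_cellular_close`, Hatcher Thm. 4.8 for cube complexes), so `g ≃ e` in `K`
   and `T(g) ≃ T(e)` (`MappingTelescopeHomotopy.lean`, Hatcher's fact (1));
3. `T(g)` is a CW complex (`MappingTelescopeCWComplex.lean`), moved to the universe of `Y`
   (`CWTransfer.ofHomeomorph`).

* `Literature.AlgebraicTopology.Homotopy.exists_cwComplex_homotopyEquiv_of_isNeighbourhoodRetract'`: as
  `exists_cwComplex_homotopyEquiv_of_isNeighbourhoodRetract`, without the Prop. A.11 hypothesis.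
* `Literature.AlgebraicTopology.Homotopy.exists_cwComplex_homotopyEquiv_of_compactSpace_of_A7`: Hatcher's Cor. A.12 for closed
  topological manifolds (the tree's named fact `exists_cwComplex_homotopyEquiv_of_compactSpace`)
  from Thm. A.7 ALONE (`isNeighbourhoodRetract_of_locallyContractibleSpace`).

No `sorry`.

## References

* A. Hatcher, *Algebraic Topology*, CUP (2002), Appendix, Thm. A.7, Cor. A.9, Prop. A.11 and its
  proof (p. 528), Cor. A.12 (p. 529); §4.1 Thm. 4.8. [HatcherAT2002]
-/

noncomputable section

open Set Function Metric Topology ContinuousMap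
open Literature.Topology.Euclidean

universe u

namespace Literature.AlgebraicTopology.Homotopy

/-! ### Cellularity of face-preserving maps for the lattice cube CW structure -/

/-- A map sending every closed `m`-face of a lattice cube complex into its `m`-skeleton is
cellular (in the pointwise sense of `Telescope.IsCellular`) for the CW structure
`LatticeCube.cwComplex`. [folklore] -/
theorem isCellular_of_mapsTo_skel {N : ℕ} {h : ℝ} (hh : 0 < h) (𝒬 : Finset (Fin N → ℤ))
    {g : (Fin N → ℝ) → (Fin N → ℝ)}
    (hg : ∀ F ∈ LatticeCube.faces 𝒬, MapsTo g (F.carrier h) (LatticeCube.skel 𝒬 h F.S.card)) :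
    letI := LatticeCube.cwComplex 𝒬 h hh
    Telescope.IsCellular (LatticeCube.complex 𝒬 h) g := by
  letI := LatticeCube.cwComplex 𝒬 h hh
  intro n c w hw
  -- the chart of `c` is the face chart `param`
  have hchart : ∀ (m : ℕ) (c : LatticeCube.Cell 𝒬 m) (w : Fin m → ℝ),
      Telescope.chart (K := LatticeCube.complex 𝒬 h) m c w = c.1.param h c.2.2 w := fun _ _ _ => rfl
  rw [hchart]
  have hx : c.1.param h c.2.2 w ∈ c.1.carrier h := LatticeCube.Face.param_mem_carrier hh w
  obtain ⟨F', hF', hF'm, hmem⟩ := LatticeCube.mem_skel.1 (hg c.1 c.2.1 hx)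
  refine ⟨F'.S.card, by rw [c.2.2] at hF'm; exact hF'm, ⟨F', hF', rfl⟩, F'.coord h rfl (g _),
    LatticeCube.Face.coord_mem_closedBall hh hmem, ?_⟩
  rw [hchart]
  exact (LatticeCube.Face.param_coord hh hmem).symm

/-! ### The empty case -/

/-- An empty space is homotopy equivalent to the (empty, discrete) CW complex `ULift (Fin 0)`.
[folklore] -/
theorem exists_cwComplex_homotopyEquiv_of_isEmpty (Y : Type u) [TopologicalSpace Y] [IsEmpty Y] :
    ∃ (C : Type u) (_ : TopologicalSpace C) (_ : T2Space C)
      (_ : Topology.CWComplex (Set.univ : Set C)), Nonempty (Y ≃ₕ C) := by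
  refine ⟨ULift.{u} (Fin 0), inferInstance, inferInstance, inferInstance, ⟨?_⟩⟩
  haveI : IsEmpty (ULift.{u} (Fin 0)) := inferInstance
  let e : Y ≃ₜ ULift.{u} (Fin 0) :=
    { toEquiv := Equiv.equivOfIsEmpty Y (ULift.{u} (Fin 0))
      continuous_toFun := continuous_def.2 fun s _ => by
        rw [Set.eq_empty_of_isEmpty (_ ⁻¹' s)]; exact isOpen_empty
      continuous_invFun := continuous_def.2 fun s _ => by
        rw [Set.eq_empty_of_isEmpty (_ ⁻¹' s)]; exact isOpen_empty }
  exact e.toHomotopyEquiv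

/-! ### The main theorem -/

/-- **A compact Euclidean neighbourhood retract is homotopy equivalent to a CW complex**
(Hatcher 2002, Cor. A.8 + Prop. A.11, PROVED for compact ENRs along the proof of Prop. A.11:
`T(g) ≃ T(e) ≃ Y` for the idempotent `e = f r` of a cubical neighbourhood and a cellular
approximation `g` of `e`): if `f : Y → ℝᴺ` is a closed embedding with compact image which is a
retract of a neighbourhood, then `Y ≃ C` for a Hausdorff CW complex `C` of the universe of `Y`.
Same statement as `exists_cwComplex_homotopyEquiv_of_isNeighbourhoodRetract`, without the
Prop. A.11 hypothesis. [cite: HatcherAT2002, Prop. A.11 (proof) and Cor. A.12] -/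
theorem exists_cwComplex_homotopyEquiv_of_isNeighbourhoodRetract' {Y : Type u} [TopologicalSpace Y]
    {N : ℕ} {f : Y → (Fin N → ℝ)} (hf : IsClosedEmbedding f) (hc : IsCompact (range f))
    (hK : IsNeighbourhoodRetract (range f)) :
    ∃ (C : Type u) (_ : TopologicalSpace C) (_ : T2Space C)
      (_ : Topology.CWComplex (Set.univ : Set C)), Nonempty (Y ≃ₕ C) := by
  classical
  rcases isEmpty_or_nonempty Y with hY | hY
  · exact exists_cwComplex_homotopyEquiv_of_isEmpty Y
  obtain ⟨y₀⟩ := hY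
  set S : Set (Fin N → ℝ) := range f with hS
  -- the neighbourhood retraction and a margin `δ₀`
  obtain ⟨U, hUo, hSU, r, hr⟩ := hK.exists_retraction
  obtain ⟨δ₀, hδ₀, hδ₀U⟩ := hc.exists_cthickening_subset_open hUo hSU
  -- the ambient retraction data: `j = f`, `rY = f⁻¹ ∘ r`
  let eY : Y ≃ₜ S := hf.isEmbedding.toHomeomorph
  let z₀ : S := ⟨f y₀, y₀, rfl⟩
  let et : (Fin N → ℝ) → (Fin N → ℝ) := fun x => if hx : x ∈ U then ((r ⟨x, hx⟩ : S) : Fin N → ℝ) else x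
  have hetU : ∀ x (hx : x ∈ U), et x = ((r ⟨x, hx⟩ : S) : Fin N → ℝ) := fun x hx => by simp [et, hx]
  have hetS : ∀ x ∈ U, et x ∈ S := fun x hx => by rw [hetU x hx]; exact (r ⟨x, hx⟩).2
  have hetfix : ∀ x ∈ S, et x = x := fun x hx => by
    rw [hetU x (hSU hx), hr x hx]
  have hetc : ContinuousOn et U := by
    rw [continuousOn_iff_continuous_restrict]
    have : U.restrict et = fun x : U => ((r x : S) : Fin N → ℝ) := by
      funext x; exact hetU x x.2
    rw [this]
    exact continuous_subtype_val.comp r.continuous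
  let rY : (Fin N → ℝ) → Y := fun x => eY.symm (CWTransfer.toSubtype z₀ (et x))
  have hrYc : ContinuousOn rY U := by
    refine eY.symm.continuous.comp_continuousOn ((CWTransfer.continuousOn_toSubtype z₀).comp hetc hetS)
  have hrYf : ∀ y, rY (f y) = y := fun y => by
    show eY.symm (CWTransfer.toSubtype z₀ (et (f y))) = y
    rw [hetfix (f y) ⟨y, rfl⟩, CWTransfer.toSubtype_of_mem z₀ (⟨y, rfl⟩ : f y ∈ S)]
    exact hf.isEmbedding.toHomeomorph_symm_apply y
  have hfrY : ∀ x ∈ U, f (rY x) = et x := fun x hx => by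
    show f (eY.symm (CWTransfer.toSubtype z₀ (et x))) = et x
    rw [CWTransfer.toSubtype_of_mem z₀ (hetS x hx)]
    have := congrArg Subtype.val (eY.apply_symm_apply ⟨et x, hetS x hx⟩)
    exact this
  -- uniform continuity of `et` on the compact `C = cthickening (δ₀/2) S`
  set C : Set (Fin N → ℝ) := cthickening (δ₀ / 2) S with hC
  have hCc : IsCompact C := hc.cthickening
  have hCU : C ⊆ U := (cthickening_mono (by linarith) S).trans hδ₀U
  have hunif := hCc.uniformContinuousOn_of_continuous (hetc.mono hCU)
  set ε : ℝ := δ₀ / (16 * (N + 2)) with hε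
  have hε0 : 0 < ε := by rw [hε]; positivity
  obtain ⟨θ, hθ, hθε⟩ := Metric.uniformContinuousOn_iff.1 hunif ε hε0
  -- the mesh `h`, the oscillation `η = ε`, the thickness radius `R`
  set h : ℝ := min (θ / 2) ε with hh'
  have hh : 0 < h := lt_min (by linarith) hε0
  have hhθ : h < θ := (min_le_left _ _).trans_lt (by linarith)
  have hhε : h ≤ ε := min_le_right _ _
  set D : ℝ := h + N * (2 * ε + h) with hD
  set R : ℝ := D + ε + h with hR
  have hN0 : (0 : ℝ) ≤ N := Nat.cast_nonneg N
  have hD0 : 0 ≤ D := by rw [hD]; positivity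
  have hR0 : 0 ≤ R := by rw [hR]; positivity
  have hRδ : R + h ≤ δ₀ / 2 := by
    -- `R + h ≤ ε + N (3 ε) + ε + ε + ε = (3N + 4) ε ≤ 4 (N + 2) ε = δ₀ / 4`
    have h1 : R + h ≤ (3 * N + 4) * ε := by
      rw [hR, hD]; nlinarith
    have h2 : (3 * N + 4) * ε ≤ δ₀ / 4 := by
      have h3 : (0 : ℝ) < 16 * (N + 2) := by positivity
      have h4 : (3 * N + 4) * ε = δ₀ * ((3 * N + 4) / (16 * (N + 2))) := by
        rw [hε]; field_simp
      have h5 : (3 * (N : ℝ) + 4) / (16 * (N + 2)) ≤ 1 / 4 := by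
        rw [div_le_iff₀ h3]; nlinarith
      rw [h4]
      nlinarith [mul_le_mul_of_nonneg_left h5 hδ₀.le]
    linarith
  -- the cube complex: cubes meeting `cthickening R S`
  have hfin := LatticeCube.finite_setOf_carrier_top_inter_nonempty hh
    (S := cthickening R S) hc.cthickening.isBounded
  set 𝒬 : Finset (Fin N → ℤ) := hfin.toFinset with h𝒬
  have h𝒬mem : ∀ b, b ∈ 𝒬 ↔ ((LatticeCube.Face.top N b).carrier h ∩ cthickening R S).Nonempty :=
    fun b => by rw [h𝒬, Set.Finite.mem_toFinset]; rfl
  set K : Set (Fin N → ℝ) := LatticeCube.complex 𝒬 h with hKdef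
  have hSK : S ⊆ K := fun x hx =>
    LatticeCube.mem_complex.2 ⟨_, (h𝒬mem _).2 ⟨x, LatticeCube.mem_carrier_top_floor hh x,
      self_subset_cthickening S hx⟩, LatticeCube.mem_carrier_top_floor hh x⟩
  have hKC : K ⊆ C := by
    intro x hx
    obtain ⟨b, hb, hxb⟩ := LatticeCube.mem_complex.1 hx
    obtain ⟨z, hzb, hzS⟩ := (h𝒬mem b).1 hb
    have h1 : x ∈ cthickening h (cthickening R S) :=
      mem_cthickening_of_dist_le x z h _ hzS (LatticeCube.dist_le_of_mem_carrier_top hh.le hxb hzb)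
    have h2 := cthickening_cthickening_subset hh.le hR0 S h1
    exact cthickening_mono (by linarith) S h2
  have hKU : K ⊆ U := hKC.trans hCU
  have hKc : IsCompact K := LatticeCube.isCompact_complex
  -- the retraction data on `K`
  let RD : Telescope.RetractionData K Y :=
    { j := f
      r := rY
      continuous_j := hf.continuous
      continuousOn_r := hrYc.mono hKU
      j_mem := fun y => hSK ⟨y, rfl⟩
      r_j := hrYf }
  have hRDe : ∀ x ∈ K, RD.e x = et x := fun x hx => hfrY x (hKU hx)
  -- the hypotheses of cellular approximation for `RD.e` on `K`
  have hHyp : LatticeCube.ApproxHyp 𝒬 h RD.e ε R :=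
    { hh := hh
      hη := hε0.le
      osc := fun x hx y hy hxy => by
        rw [hRDe x hx, hRDe y hy]
        exact (hθε x (hKC hx) y (hKC hy) (hxy.trans_lt hhθ)).le
      thick := fun x hx b hb => by
        obtain ⟨z, hzb, hz⟩ := hb
        refine (h𝒬mem b).2 ⟨z, hzb, ?_⟩
        have hex : RD.e x ∈ S := by rw [hRDe x hx]; exact hetS x (hKU hx)
        exact mem_cthickening_of_dist_le z (RD.e x) R S hex (mem_closedBall.1 hz) }
  obtain ⟨g, hgc, hgcell, hgdist⟩ := LatticeCube.exists_cellular_close hHyp (by rw [hR, hD])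
  -- `g ≃ e` inside `K` along straight segments
  have hseg : ∀ x ∈ K, segment ℝ (g x) (RD.e x) ⊆ K := fun x hx =>
    LatticeCube.segment_subset_complex_of_thick hHyp hD0 (by rw [hR]; linarith [hε0.le]) hx
      (hgdist x hx)
  let HD : Telescope.HomotopyData K RD.e g :=
    { H := fun x t => (1 - t) • g x + t • RD.e x
      continuousOn_H := by
        refine ContinuousOn.add ?_ ?_
        · exact ((continuous_const.sub continuous_snd).continuousOn).smul
            (hgc.comp continuousOn_fst fun p hp => hp.1)
        · exact continuous_snd.continuousOn.smul (RD.continuousOn_e.comp continuousOn_fst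
            fun p hp => hp.1)
      H_mem := fun x hx t ht => hseg x hx ⟨1 - t, t, by linarith [ht.2], ht.1, by ring, rfl⟩
      H_zero := fun x => by simp
      H_one := fun x => by simp }
  -- the CW structure on `T(g)` and the equivalences
  letI : Topology.CWComplex (Set.univ : Set ↥K) := LatticeCube.cwComplex 𝒬 h hh
  haveI : Topology.RelCWComplex.Finite (Set.univ : Set ↥K) := LatticeCube.finite_cwComplex hh
  have hcell : Telescope.IsCellular K g := isCellular_of_mapsTo_skel hh 𝒬 hgcell
  letI : Topology.CWComplex (Telescope.space g K) := Telescope.cwComplex hgc hcell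
  let Tg : Type u := ULift.{u} ↥(Telescope.space g K)
  letI : Topology.CWComplex (Set.univ : Set Tg) :=
    CWTransfer.ofHomeomorph.{0, u} (C := Telescope.space g K) Homeomorph.ulift.{u}.symm
  have E1 : Y ≃ₕ ↥(Telescope.space RD.e K) := (RD.homotopyEquiv hKc).symm
  have E2 : ↥(Telescope.space RD.e K) ≃ₕ ↥(Telescope.space g K) :=
    Telescope.homotopyEquivOfHomotopy hKc RD.continuousOn_e hgc HD
  have E3 : ↥(Telescope.space g K) ≃ₕ Tg := (Homeomorph.ulift.{u}.symm).toHomotopyEquiv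
  exact ⟨Tg, inferInstance, inferInstance, inferInstance, ⟨(E1.trans E2).trans E3⟩⟩

/-- **A compact manifold is homotopy equivalent to a CW complex (Hatcher 2002, Cor. A.12), from
Thm. A.7 alone.** The tree's named fact `exists_cwComplex_homotopyEquiv_of_compactSpace`
(closed topological `n`-manifolds) follows from the named fact
`isNeighbourhoodRetract_of_locallyContractibleSpace` (Hatcher Thm. A.7) by the embedding theorem
(`Literature.Geometry.Manifold.exists_isClosedEmbedding_pi_of_compactSpace`), local
contractibility of manifolds, and the PROVED CW type of compact ENRs
(`exists_cwComplex_homotopyEquiv_of_isNeighbourhoodRetract'`). [cite: HatcherAT2002, Cor. A.12] -/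
theorem exists_cwComplex_homotopyEquiv_of_compactSpace_of_A7
    (h7 : isNeighbourhoodRetract_of_locallyContractibleSpace) :
    exists_cwComplex_homotopyEquiv_of_compactSpace.{u} := by
  intro M _ _ _ n _
  obtain ⟨N, f, hf⟩ :=
    Geometry.Manifold.exists_isClosedEmbedding_pi_of_compactSpace (M := M)
      (EuclideanSpace ℝ (Fin n))
  exact exists_cwComplex_homotopyEquiv_of_isNeighbourhoodRetract' hf (isCompact_range hf.continuous)
    (isNeighbourhoodRetract_range_of_compactSpace h7 (EuclideanSpace ℝ (Fin n)) hf.isEmbedding)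

end Literature.AlgebraicTopology.Homotopy

end
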